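import Literature.NumberTheory.Rogawski1990.ArchExplicitTransferFactorTauContinuous   -- ★ `continuousAt_archHeckeValue`, `archHeckeValue_ne_zero_of_isUnit` (via …Regular)
import Literature.NumberTheory.Rogawski1990.ArchExplicitTransferFactorCentral         -- ★ `archHeckeValue_mul`
import Literature.Analysis.SpecialFunctions.ContinuousMultiplicativeCharacterDifferentiable  -- ★∕rf (B-p17 (g23)): `differentiableAt_of_map_mul_of_isUnit`
import HarnessLib

/-!
# `μ_∞` is differentiable: the archimedean component of a Hecke character is (real-)differentiable at every unit of `L ⊗ ℝ`
# (Rogawski 1990 §4.9 p. 55, §8.2 p. 123 «`μ_w(z) = (z∕|z|)^{t_w}|z|^{s_w}`»; Tate's thesis §2.3, §4.3)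

Topic `NumberTheory/Rogawski1990`; namespace `Literature.NumberTheory.Rogawski1990`.  THEOREMS ONLY (no `def`, no instance, no notation, no axiom, no
`sorry`).  Cell `pub/hodgecm-mathlib`, ENGINE T1 (crux H413 = `stmt-HodgeConjecture-24833`); floor-1 preparation, count-neutral, brick «μ_∞ SMOOTH»
(LEAD F0P3a-plan (g9) WORD T8-2 (8), 2026-09-01; author B-p17 (g23)) — the docking half: F0P3a-p05 (g10)'s (L-jump)-Δ binder
`hμ′ : DifferentiableAt ℝ (archHeckeValue L μ) (archTauArg L (γH 0))` is discharged at every UNIT argument.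

WHAT IS PROVED. **`differentiableAt_archHeckeValue (μ) (hx : IsUnit x) : DifferentiableAt ℝ (archHeckeValue L μ) x`** for ANY number field `L` and ANY
Hecke character `μ` (unitarity not needed): ★ `archHeckeValue` (`μ ∘ infiniteIdeles ∘ (L_∞ ≃ L ⊗ ℝ)⁻¹` on units) is multiplicative (★ `archHeckeValue_mul`),
non-vanishing (★ `archHeckeValue_ne_zero_of_isUnit`) and continuous (★ `continuousAt_archHeckeValue`) on the unit group of
`L ⊗ ℝ = ({w ∕∕ IsReal} → ℝ) × ({w ∕∕ IsComplex} → ℂ)`, so the generic theorem ★ `differentiableAt_of_map_mul_of_isUnit` (continuous multiplicative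
characters of `ℝˣ`, `ℂˣ` are exponentials in `log`, hence differentiable) applies.  HONEST LABEL: HC_CM is proved only modulo the printed citations until
rung 0 closes; this file is bookkeeping and pays nothing by itself.

## References
* [Rogawski1990] J. D. Rogawski, *Automorphic Representations of Unitary Groups in Three Variables*, Ann. of Math. Stud. 123 (1990): §4.9 p. 55 (`μ` and
  `τ(γ) = μ(γ₁)`), §8.2 p. 123 (the archimedean characters `μ_w(z) = (z∕|z|)^{t}|z|^{s}` in the limit formulas).
* [TateThesis1967] J. Tate, *Fourier analysis in number fields and Hecke's zeta-functions*, in Cassels–Fröhlich (1967), §2.3 (quasi-characters of local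
  fields), §4.3 (quasi-characters of the idèle group).
-/

set_option autoImplicit false

noncomputable section

open NumberField NumberField.InfinitePlace
open Literature.NumberTheory.GaloisRepresentations Literature.Analysis.SpecialFunctions

namespace Literature.NumberTheory.Rogawski1990

variable (L : Type) [Field L] [NumberField L]

/-- **`μ_∞` IS DIFFERENTIABLE AT EVERY UNIT OF `L ⊗ ℝ`**: for a Hecke character `μ` of a number field `L` and a unit `x ∈ L ⊗ ℝ` (all coordinates non-zero),
the archimedean value function ★ `archHeckeValue L μ` is real-differentiable at `x` — the (L-jump)-Δ binder `hμ′` of the explicit-transfer-factor road,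
discharged.  (Continuous multiplicative characters of `ℝˣ` and `ℂˣ` are `a ↦ χ(a₀)·exp(c·log(a∕a₀))` ∕ `z ↦ χ(z₀)·exp(c₁ re log(z∕z₀) + c₂ im log(z∕z₀))` near each
point — print's «`μ_w(z) = (z∕|z|)^{t_w}|z|^{s_w}`» — ★ `differentiableAt_of_map_mul_of_isUnit`.) [cite: Rogawski1990, §4.9 p. 55; §8.2 p. 123]
[cite: TateThesis1967, §2.3; §4.3] -/
theorem differentiableAt_archHeckeValue (μ : HeckeCharacter L) {x : mixedEmbedding.mixedSpace L} (hx : IsUnit x) :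
    DifferentiableAt ℝ (archHeckeValue L μ) x := by
  classical
  exact differentiableAt_of_map_mul_of_isUnit (fun y z hy hz => archHeckeValue_mul L μ hy hz)
    (fun y hy => continuousAt_archHeckeValue L μ hy) (fun y hy => archHeckeValue_ne_zero_of_isUnit L μ hy) hx

end Literature.NumberTheory.Rogawski1990
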